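import Mathlib
import HarnessLib
import Literature.Combinatorics.AssociationSchemes.Basic
import Summits.MatrixMultiplication.MatrixMultiplication.Theses.CommutativeSchemes
import Summits.MatrixMultiplication.MatrixMultiplication.Theorems.CommutativeSchemesCommutativeRealizationStubCommutativeRealizationCube
import Summits.MatrixMultiplication.MatrixMultiplication.Theorems.CommutativeSchemesCommutativeRealizationStubConjugacyScheme

/-!
# Bridge: conjugacy-class designs ⟹ `CommutativeRealization` (CU13 Conjecture 21, ε-form)

Crux `CommutativeRealization` (stmt-MatrixMultiplication-9462) of route `CommutativeSchemes`, alternative line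
`conjugacy` (`Cruxes/CommutativeRealization/Lines/conjugacy.lean`, CU13 §6.3 group association schemes). This
file is the KERNEL-CHECKED REDUCTION of the crux to that line's single open stub, stated as a conditional
theorem: if for every `ε > 0` there is a finite group `G` whose conjugacy class map `(x, y) ↦ [x⁻¹ y]` realises
some rectangle `⟨l, m, n⟩`, `lmn ≥ 2`, with `k(G) ≤ (lmn)^((2+ε)/3)` conjugacy classes (Cohn–Umans 2013
Conjecture 21 restricted to the group association schemes of §6.3, shape relaxed — an OPEN CONJECTURE, kept as
the explicit hypothesis `hA` and not dressed as a fact), then `CommutativeRealization` holds. The proof composes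
two tree theorems: the group association scheme is a commutative association scheme
(`stub_conjugacyScheme`, CU13 §4.2/§6.3) and the cube of a commutative realisation
(`stub_commutativeRealization_cube`, CU13 §4.2 + proof of Thm. 17 ¶1), followed by the exponent bookkeeping
`r' ≤ k(G)³ ≤ ((lmn)^((2+ε)/3))³ = (lmn)^(2+ε)`.

References: H. Cohn, C. Umans, *Fast matrix multiplication using coherent configurations*, SODA 2013
(arXiv:1207.6528), Conj. 21, §6.3, Prop. 14, Thm. 17; E. Bannai, T. Ito, *Algebraic Combinatorics I* (1984),
§II.7.
-/

-- `Summit.<Summit>.<Problem>`: for the single-conjunct summit the duplicate component is mandated.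
set_option linter.dupNamespace false

namespace Summit.MatrixMultiplication.MatrixMultiplication.Theorems

open Literature.Combinatorics.AssociationSchemes
open Summit.MatrixMultiplication.MatrixMultiplication.Theses.CommutativeSchemes

/-- **Bridge (conditional result).** Conjugacy-class designs at the cube-root exponent — for every `ε > 0` a
finite group `G` and a shape `lmn ≥ 2` such that the conjugacy class map `(x, y) ↦ [x⁻¹ y]` realises
`⟨l, m, n⟩` (CU13 Def. 12) with `k(G) ≤ (lmn)^((2+ε)/3)` (CU13 Conj. 21 restricted to the group association
schemes of §6.3; OPEN, kept as the explicit hypothesis `hA`) — imply the crux `CommutativeRealization`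
(CU13 Conjecture 21 in ε-form): renumber the classes into `Fin k(G)` to get a commutative association scheme
(`stub_conjugacyScheme`; realisation transported by `Realizes.map`), cube it
(`stub_commutativeRealization_cube`: a commutative scheme on `G × G × G` with at most `k(G)³ ≤ (lmn)^(2+ε)`
labels realising `⟨N, N, N⟩`, `N = lmn ≥ 2`), and unpack the scheme axioms into the route's inlined clauses.
[cite: CohnUmans2013, Conj. 21, §6.3, Thm. 17] -/
theorem commutativeRealization_of_conjugacyClassDesign
    (hA : ∀ ε : ℝ, 0 < ε → ∃ (G : Type) (_ : Group G) (_ : Fintype G) (l m n : ℕ),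
      2 ≤ l * m * n ∧
        (Nat.card (ConjClasses G) : ℝ) ≤ ((l * m * n : ℕ) : ℝ) ^ ((2 + ε) / 3) ∧
          Realizes (fun x y : G => ConjClasses.mk (x⁻¹ * y)) l m n) :
    CommutativeRealization := by
  intro ε hε
  obtain ⟨G, _instG, _instF, l, m, n, h2, hr, hreal⟩ := hA ε hε
  obtain ⟨e, S, he, hScomm, hcls⟩ := stub_conjugacyScheme G
  -- the conjugacy class map, renumbered into `Fin k(G)`, is the class map of the scheme `S`
  have hfun : S.cls = fun x y : G => e (ConjClasses.mk (x⁻¹ * y)) :=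
    funext fun x => funext fun y => hcls x y
  have hSreal : S.Realizes l m n := by
    show Realizes S.cls l m n
    rw [hfun]
    exact Realizes.map he hreal
  -- cube it
  obtain ⟨r', T, hr', hTcomm, hTreal⟩ :=
    stub_commutativeRealization_cube G l m n (Nat.card (ConjClasses G)) S hScomm hSreal
  refine ⟨l * m * n, h2, G × G × G, inferInstance, r', T.cls, ?_, T.cls_eq_cls_self_iff,
    T.exists_transpose, T.isCommutative_iff.1 hTcomm, hTreal⟩
  -- the count: `r' ≤ k(G)³ ≤ ((lmn)^((2+ε)/3))³ = (lmn)^(2+ε)`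
  have h0 : (0 : ℝ) ≤ ((l * m * n : ℕ) : ℝ) := Nat.cast_nonneg _
  have h1 : (r' : ℝ) ≤ (Nat.card (ConjClasses G) : ℝ) ^ (3 : ℕ) := by exact_mod_cast hr'
  have h2' : (Nat.card (ConjClasses G) : ℝ) ^ (3 : ℕ) ≤
      (((l * m * n : ℕ) : ℝ) ^ ((2 + ε) / 3)) ^ (3 : ℕ) :=
    pow_le_pow_left₀ (Nat.cast_nonneg _) hr 3
  have h3 : (((l * m * n : ℕ) : ℝ) ^ ((2 + ε) / 3)) ^ (3 : ℕ) = ((l * m * n : ℕ) : ℝ) ^ (2 + ε) := by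
    rw [← Real.rpow_natCast, ← Real.rpow_mul h0]
    congr 1
    push_cast
    ring
  calc (r' : ℝ) ≤ (Nat.card (ConjClasses G) : ℝ) ^ (3 : ℕ) := h1
    _ ≤ (((l * m * n : ℕ) : ℝ) ^ ((2 + ε) / 3)) ^ (3 : ℕ) := h2'
    _ = ((l * m * n : ℕ) : ℝ) ^ (2 + ε) := h3

end Summit.MatrixMultiplication.MatrixMultiplication.Theorems
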